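import Mathlib.NumberTheory.Padics.RingHoms
import Mathlib.NumberTheory.Padics.ProperSpace
import Mathlib.NumberTheory.Multiplicity
import Mathlib.Algebra.MvPolynomial.Eval
import Mathlib.Algebra.Module.ZMod
import Mathlib.Algebra.Field.ZMod
import Mathlib.LinearAlgebra.Dimension.Free
import Mathlib.LinearAlgebra.Basis.VectorSpace
import Mathlib.LinearAlgebra.FiniteDimensional.Defs
import Mathlib.Topology.Algebra.OpenSubgroup
import Mathlib.Topology.Algebra.Ring.Basic
import Mathlib.Topology.Algebra.Group.Basic
import Mathlib.Topology.Algebra.ContinuousMonoidHom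
import Mathlib.Topology.Instances.ZMod
import Mathlib.FieldTheory.Finiteness
import HarnessLib

/-!
# The `ℤ_p`-rank of the one-units of a compact `p`-adic ring (proofs only)

Topic `NumberTheory/GaloisRepresentations` (local fields; structure of unit groups); namespace
`Literature.OneUnits`.  No new definitions.

Let `A` be a compact Hausdorff topological commutative ring and `p` a prime number which is a
non-zero-divisor of `A`, lies in the Jacobson radical (`1 + pa ∈ Aˣ` for all `a`) and generates
open ideals `p^m A` — the model being the valuation ring `𝒪_v` of a finite place `v ∣ p` of a
number field (`LocalOneUnitsNumberFieldProofs.lean`).  Put `p^n = #(A/pA)` (for `A = 𝒪_v`,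
`n = e_v f_v = [K_v : ℚ_p]`).  This file proves the structure theorem for the one-units
`U_k = 1 + p^k A` in the form needed for the `ℤ_p`-rank of a number field (Washington,
*Introduction to Cyclotomic Fields*, §13.1, proof of Thm. 13.4: "`U_{1,𝔭} ≃ (finite group) ×
ℤ_p^{[K_𝔭:ℚ_p]}`"; Neukirch, *Algebraic Number Theory*, Ch. II (5.7) (i); Serre, *Local Fields*,
Ch. IV §2 Prop. 6, §3 Prop. 9), without logarithms:

* algebra of the filtration (`exists_mul_eq`, `exists_inv_eq`, `exists_zpow_eq`,
  `exists_prod_zpow_eq`: `U_k/U_{k+1} → A/p` is a homomorphism; `exists_pow_prime_eq`,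
  `exists_pow_prime_pow_eq`: for `k ≥ 2` the `p`-th power maps `U_k` to `U_{k+1}` preserving the
  digit, from `(1+x)^p ≡ 1 + px (mod x²)`);
* the basis inductions (`exists_zpow_approx`, `dvd_of_prod_zpow`): with `uᵢ = 1 + p² aᵢ`,
  `(aᵢ mod p)` an `𝔽_p`-basis of `A/p`, every `w ∈ U₂` is `≡ ∏ uᵢ^{cᵢ} (mod U_{2+m})` with
  `cᵢ ∈ ℤ` unique modulo `p^m`;
* `p`-adic utilities (`continuous_toZModPow`, `continuous_of_toZModPow_eventually_eq`,
  `exists_basis_int`);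
* the main theorems: `exists_continuousMonoidHom_forall_exists_ker` /
  `exists_continuousMonoidHom_forall_exists` — `n` continuous characters `φᵢ : Aˣ → ℤ_p`
  (coordinates of `x^h`, `h = [Aˣ : U₂]`, glued by `PadicInt.lift`) with joint image
  `⊇ p^N ℤ_pⁿ` (compactness), and kernel `⊆ {x | x^h ≡ 1 (mod p^m) ∀ m}`;
  `exists_continuousMonoidHom_forall_exists_isOfFinOrder` — if `⋂ p^m A = 0` the kernel is
  torsion; `exists_forall_pow_mul_eq_sum` — then every continuous `ψ : Aˣ → ℤ_p` satisfies
  `p^N ψ = ∑ cᵢ φᵢ`: `rank_{ℤ_p} Hom_cont(Aˣ, ℤ_p) = n` exactly.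

## References

* J.-P. Serre, *Local Fields*, GTM 67, Ch. IV §2 Prop. 6, §3 Prop. 9, Ch. XIV §4.
* J. Neukirch, *Algebraic Number Theory*, Springer 1999, Ch. II (5.7).
* L. C. Washington, *Introduction to Cyclotomic Fields*, 2nd ed., GTM 83, §13.1, Thm. 13.4.
-/

noncomputable section

open Topology

namespace Literature.NumberTheory.GaloisRepresentations

namespace OneUnits

section Algebra

variable {A : Type*} [CommRing A] {P : A} {k : ℕ}

/-- Product of one-units of level `k ≥ 1`: `(1 + P^k a)(1 + P^k b) = 1 + P^k d` with
`d ≡ a + b (mod P)`.  Ref: Serre, *Local Fields*, Ch. IV §2, Prop. 6 (`U^n/U^{n+1} ≅ 𝔭^n/𝔭^{n+1}`).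
[folklore] -/
theorem exists_mul_eq (hk : 1 ≤ k) {u w : Aˣ} {a b : A} (hu : (u : A) = 1 + P ^ k * a)
    (hw : (w : A) = 1 + P ^ k * b) :
    ∃ d, ((u * w : Aˣ) : A) = 1 + P ^ k * d ∧
      Ideal.Quotient.mk (Ideal.span {P}) d =
        Ideal.Quotient.mk (Ideal.span {P}) a + Ideal.Quotient.mk (Ideal.span {P}) b := by
  refine ⟨a + b + P ^ k * a * b, ?_, ?_⟩
  · rw [Units.val_mul, hu, hw]; ring
  · have h0 : Ideal.Quotient.mk (Ideal.span {P}) (P ^ k * a * b) = 0 := by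
      rw [Ideal.Quotient.eq_zero_iff_mem]
      obtain ⟨k', rfl⟩ := Nat.exists_eq_add_of_le hk
      exact Ideal.mem_span_singleton'.2 ⟨P ^ k' * a * b, by ring⟩
    rw [map_add, map_add, h0, add_zero]

/-- A one-unit of level `k ≥ 1` is `≡ 1 (mod P)`. [folklore] -/
theorem mk_coe_eq_one (hk : 1 ≤ k) {u : Aˣ} {a : A} (hu : (u : A) = 1 + P ^ k * a) :
    Ideal.Quotient.mk (Ideal.span {P}) (u : A) = 1 := by
  rw [hu, map_add, map_one, add_eq_left, Ideal.Quotient.eq_zero_iff_mem]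
  obtain ⟨k', rfl⟩ := Nat.exists_eq_add_of_le hk
  exact Ideal.mem_span_singleton'.2 ⟨P ^ k' * a, by ring⟩

/-- Inverse of a one-unit of level `k ≥ 1`: `(1 + P^k a)⁻¹ = 1 + P^k d` with `d ≡ -a (mod P)`.
Ref: Serre, *Local Fields*, Ch. IV §2, Prop. 6. [folklore] -/
theorem exists_inv_eq (hk : 1 ≤ k) {u : Aˣ} {a : A} (hu : (u : A) = 1 + P ^ k * a) :
    ∃ d, ((u⁻¹ : Aˣ) : A) = 1 + P ^ k * d ∧
      Ideal.Quotient.mk (Ideal.span {P}) d = -Ideal.Quotient.mk (Ideal.span {P}) a := by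
  refine ⟨-(a * ↑u⁻¹), ?_, ?_⟩
  · have h1 : ((u⁻¹ : Aˣ) : A) * (u : A) = 1 := by rw [← Units.val_mul, inv_mul_cancel, Units.val_one]
    have h2 : ((u⁻¹ : Aˣ) : A) * (1 + P ^ k * a) = 1 := by rw [← hu]; exact h1
    linear_combination h2
  · have hinv : Ideal.Quotient.mk (Ideal.span {P}) ((u⁻¹ : Aˣ) : A) = 1 := by
      have h1 := mk_coe_eq_one hk hu
      have h2 : Ideal.Quotient.mk (Ideal.span {P}) ((u⁻¹ : Aˣ) : A) *
          Ideal.Quotient.mk (Ideal.span {P}) (u : A) = 1 := by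
        rw [← map_mul, ← Units.val_mul, inv_mul_cancel, Units.val_one, map_one]
      rwa [h1, mul_one] at h2
    rw [map_neg, map_mul, hinv, mul_one]

/-- Integer powers of a one-unit of level `k ≥ 1`: `(1 + P^k a)^c = 1 + P^k d` with
`d ≡ c a (mod P)`.  Ref: Serre, *Local Fields*, Ch. IV §2, Prop. 6. [folklore] -/
theorem exists_zpow_eq (hk : 1 ≤ k) {u : Aˣ} {a : A} (hu : (u : A) = 1 + P ^ k * a) (c : ℤ) :
    ∃ d, ((u ^ c : Aˣ) : A) = 1 + P ^ k * d ∧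
      Ideal.Quotient.mk (Ideal.span {P}) d = c • Ideal.Quotient.mk (Ideal.span {P}) a := by
  induction c using Int.induction_on with
  | zero => exact ⟨0, by simp, by simp⟩
  | succ c ih =>
    obtain ⟨d, hd, hdq⟩ := ih
    obtain ⟨d', hd', hdq'⟩ := exists_mul_eq hk hd hu
    refine ⟨d', by rw [zpow_add_one]; exact hd', ?_⟩
    rw [hdq', hdq, add_smul, one_smul]
  | pred c ih =>
    obtain ⟨d, hd, hdq⟩ := ih
    obtain ⟨e, he, heq⟩ := exists_inv_eq hk hu
    obtain ⟨d', hd', hdq'⟩ := exists_mul_eq hk hd he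
    refine ⟨d', by rw [zpow_sub_one, ← hd'], ?_⟩
    rw [hdq', hdq, heq, sub_smul, one_smul, sub_eq_add_neg]

/-- Products of integer powers of one-units of level `k ≥ 1`:
`∏ (1 + P^k aᵢ)^{cᵢ} = 1 + P^k d` with `d ≡ ∑ cᵢ aᵢ (mod P)` — the "logarithm modulo `P`"
`U_k/U_{k+1} → A/P` is a homomorphism.  Ref: Serre, *Local Fields*, Ch. IV §2, Prop. 6. [folklore] -/
theorem exists_prod_zpow_eq (hk : 1 ≤ k) {ι : Type*} (s : Finset ι) {u : ι → Aˣ} {a : ι → A}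
    (hu : ∀ i ∈ s, (u i : A) = 1 + P ^ k * a i) (c : ι → ℤ) :
    ∃ d, ((∏ i ∈ s, u i ^ c i : Aˣ) : A) = 1 + P ^ k * d ∧
      Ideal.Quotient.mk (Ideal.span {P}) d = ∑ i ∈ s, c i • Ideal.Quotient.mk (Ideal.span {P}) (a i) := by
  classical
  induction s using Finset.induction_on with
  | empty =>
    exact ⟨0, by rw [Finset.prod_empty, Units.val_one, mul_zero, add_zero],
      by rw [map_zero, Finset.sum_empty]⟩
  | insert j s hj ih =>
    obtain ⟨d, hd, hdq⟩ := ih fun i hi => hu i (Finset.mem_insert_of_mem hi)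
    obtain ⟨e, he, heq⟩ := exists_zpow_eq hk (hu j (Finset.mem_insert_self j s)) (c j)
    obtain ⟨d', hd', hdq'⟩ := exists_mul_eq hk he hd
    refine ⟨d', by rw [Finset.prod_insert hj]; exact hd', ?_⟩
    rw [hdq', heq, hdq, Finset.sum_insert hj]

/-- If the "logarithm modulo `P`" of a one-unit of level `k` vanishes, it has level `k + 1`.
[folklore] -/
theorem exists_eq_succ_of_mk_eq_zero {u : Aˣ} {d : A} (hu : (u : A) = 1 + P ^ k * d)
    (hd : Ideal.Quotient.mk (Ideal.span {P}) d = 0) : ∃ e, (u : A) = 1 + P ^ (k + 1) * e := by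
  rw [Ideal.Quotient.eq_zero_iff_mem, Ideal.mem_span_singleton'] at hd
  obtain ⟨e, rfl⟩ := hd
  exact ⟨e, by rw [hu]; ring⟩

/-- A one-unit of level `k + 1` is a one-unit of level `k` with vanishing logarithm. [folklore] -/
theorem exists_eq_of_succ {u : Aˣ} {e : A} (hu : (u : A) = 1 + P ^ (k + 1) * e) :
    ∃ d, (u : A) = 1 + P ^ k * d ∧ Ideal.Quotient.mk (Ideal.span {P}) d = 0 :=
  ⟨P * e, by rw [hu]; ring,
    (Ideal.Quotient.eq_zero_iff_mem).2 (Ideal.mem_span_singleton'.2 ⟨e, mul_comm _ _⟩)⟩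

/-- Level `k + m` one-units are level `k` one-units. [folklore] -/
theorem exists_eq_of_add {u : Aˣ} {e : A} (m : ℕ) (hu : (u : A) = 1 + P ^ (k + m) * e) :
    ∃ d, (u : A) = 1 + P ^ k * d :=
  ⟨P ^ m * e, by rw [hu, pow_add]; ring⟩

/-- **Uniqueness of the digit** when `P` is a non-zero-divisor: `1 + P^k d = 1 + P^k d'` forces
`d = d'`. [folklore] -/
theorem digit_unique (hreg : ∀ a : A, P * a = 0 → a = 0) {x d d' : A} (h : x = 1 + P ^ k * d)
    (h' : x = 1 + P ^ k * d') : d = d' := by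
  have hk : ∀ (j : ℕ) (a : A), P ^ j * a = 0 → a = 0 := by
    intro j
    induction j with
    | zero => intro a ha; rwa [pow_zero, one_mul] at ha
    | succ j ih => intro a ha; exact ih a (hreg _ (by rw [← ha]; ring))
  have : P ^ k * (d - d') = 0 := by rw [mul_sub, sub_eq_zero]; linear_combination h.symm.trans h'
  exact sub_eq_zero.1 (hk k _ this)

/-- With `P` a non-zero-divisor, a level-`k` one-unit `1 + P^k d` has level `k + 1` iff
`d ≡ 0 (mod P)`. [folklore] -/
theorem mk_eq_zero_of_eq_succ (hreg : ∀ a : A, P * a = 0 → a = 0) {u : Aˣ} {d e : A}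
    (hu : (u : A) = 1 + P ^ k * d) (hu' : (u : A) = 1 + P ^ (k + 1) * e) :
    Ideal.Quotient.mk (Ideal.span {P}) d = 0 := by
  obtain ⟨d', hd', hq⟩ := exists_eq_of_succ hu'
  rwa [digit_unique hreg hu hd']

end Algebra

/-! ### The `p`-th power map -/

section PrimePower

variable {A : Type*} [CommRing A] (p : ℕ) {k : ℕ}

/-- **The `p`-th power raises the level by one and preserves the digit** (for `k ≥ 2`):
`(1 + p^k a)^p = 1 + p^{k+1} d` with `d ≡ a (mod p)`, from `(1+x)^p ≡ 1 + p x (mod x²)` with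
`x = p^k a`, `x² ∈ p^{k+2} A`.  Ref: Serre, *Local Fields*, Ch. IV §2, Prop. 6 and §3 Prop. 9
(`x ↦ x^p` induces `U^n/U^{n+1} → U^{n+e}/U^{n+e+1}`); Washington, *Introduction to Cyclotomic
Fields*, Lemma 13.? (structure of `U_1`). [folklore] -/
theorem exists_pow_prime_eq (hk : 2 ≤ k) {u : Aˣ} {a : A} (hu : (u : A) = 1 + (p : A) ^ k * a) :
    ∃ d, ((u ^ p : Aˣ) : A) = 1 + (p : A) ^ (k + 1) * d ∧
      Ideal.Quotient.mk (Ideal.span {(p : A)}) d = Ideal.Quotient.mk (Ideal.span {(p : A)}) a := by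
  obtain ⟨c, hc⟩ := sq_dvd_add_pow_sub_sub ((p : A) ^ k * a) 1 p
  obtain ⟨k', rfl⟩ := Nat.exists_eq_add_of_le hk
  refine ⟨a + p * ((p : A) ^ k' * a ^ 2 * c), ?_, ?_⟩
  · rw [Units.val_pow_eq_pow_val, hu]
    have hc' : (1 + (p : A) ^ (2 + k') * a) ^ p =
        ((p : A) ^ (2 + k') * a) ^ 2 * c + 1 ^ (p - 1) * ((p : A) ^ (2 + k') * a) * p + 1 ^ p := by
      linear_combination hc
    rw [hc', one_pow, one_pow]; ring
  · rw [map_add, add_eq_left, Ideal.Quotient.eq_zero_iff_mem]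
    exact Ideal.mem_span_singleton'.2 ⟨(p : A) ^ k' * a ^ 2 * c, mul_comm _ _⟩

/-- Iterating: `(1 + p^k a)^{p^m} = 1 + p^{k+m} d` with `d ≡ a (mod p)` (`k ≥ 2`). [folklore] -/
theorem exists_pow_prime_pow_eq (hk : 2 ≤ k) {u : Aˣ} {a : A} (hu : (u : A) = 1 + (p : A) ^ k * a)
    (m : ℕ) :
    ∃ d, ((u ^ p ^ m : Aˣ) : A) = 1 + (p : A) ^ (k + m) * d ∧
      Ideal.Quotient.mk (Ideal.span {(p : A)}) d = Ideal.Quotient.mk (Ideal.span {(p : A)}) a := by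
  induction m with
  | zero => exact ⟨a, by rw [pow_zero, pow_one, add_zero]; exact hu, rfl⟩
  | succ m ih =>
    obtain ⟨d, hd, hdq⟩ := ih
    obtain ⟨d', hd', hdq'⟩ := exists_pow_prime_eq p (by omega) hd
    refine ⟨d', ?_, by rw [hdq', hdq]⟩
    rw [pow_succ, pow_mul, ← add_assoc]
    exact hd'

end PrimePower

/-! ### The basis inductions -/

section Basis

variable {A : Type*} [CommRing A] (p : ℕ) {n : ℕ} {u : Fin n → Aˣ} {a : Fin n → A}

/-- **Approximation by monomials in a basis (surjectivity induction).**  Let `uᵢ = 1 + p² aᵢ`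
where the `aᵢ mod p` span `A/p`.  Then every level-`2` one-unit `w` is, for every `m`, congruent
modulo level `2 + m` to a monomial `∏ uᵢ^{cᵢ}`, `cᵢ ∈ ℤ`: correct the digit at level `2 + m` by
`∏ uᵢ^{p^m dᵢ}`, whose digit is `∑ dᵢ aᵢ`.  Ref: Serre, *Local Fields*, Ch. IV §2, Prop. 6 and
§3 Prop. 9; Neukirch, *Algebraic Number Theory*, Ch. II (5.7) (`U^{(n)} ≅ ℤ_p^d ⊕ …`).
[folklore] -/
theorem exists_zpow_approx (hspan : ∀ q : A ⧸ Ideal.span {(p : A)}, ∃ d : Fin n → ℤ,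
      q = ∑ i, d i • Ideal.Quotient.mk (Ideal.span {(p : A)}) (a i))
    (hu : ∀ i, (u i : A) = 1 + (p : A) ^ 2 * a i) (m : ℕ) (w : Aˣ)
    (hw : ∃ b, (w : A) = 1 + (p : A) ^ 2 * b) :
    ∃ (c : Fin n → ℤ) (b : A), ((w * (∏ i, u i ^ c i)⁻¹ : Aˣ) : A) = 1 + (p : A) ^ (2 + m) * b := by
  induction m with
  | zero =>
    obtain ⟨b, hb⟩ := hw
    refine ⟨0, b, ?_⟩
    simp only [Pi.zero_apply, zpow_zero, Finset.prod_const_one, inv_one, mul_one, add_zero]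
    exact hb
  | succ m ih =>
    obtain ⟨c, b, hb⟩ := ih
    obtain ⟨d, hd⟩ := hspan (Ideal.Quotient.mk _ b)
    -- the correcting monomial `∏ uᵢ^{p^m dᵢ}` has level `2 + m` and digit `∑ dᵢ aᵢ`
    have hum : ∀ i ∈ (Finset.univ : Finset (Fin n)), ((u i ^ p ^ m : Aˣ) : A) =
        1 + (p : A) ^ (2 + m) * (exists_pow_prime_pow_eq p le_rfl (hu i) m).choose :=
      fun i _ => (exists_pow_prime_pow_eq p le_rfl (hu i) m).choose_spec.1
    obtain ⟨e, he, heq⟩ := exists_prod_zpow_eq (P := (p : A)) (by omega) Finset.univ hum d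
    have heq' : Ideal.Quotient.mk (Ideal.span {(p : A)}) e = Ideal.Quotient.mk _ b := by
      rw [heq, hd]
      refine Finset.sum_congr rfl fun i _ => ?_
      rw [(exists_pow_prime_pow_eq p le_rfl (hu i) m).choose_spec.2]
    -- divide
    obtain ⟨e', he', heq''⟩ := exists_inv_eq (P := (p : A)) (by omega) he
    obtain ⟨f, hf, hfq⟩ := exists_mul_eq (P := (p : A)) (by omega) hb he'
    have hf0 : Ideal.Quotient.mk (Ideal.span {(p : A)}) f = 0 := by
      rw [hfq, heq'', heq', add_neg_cancel]
    obtain ⟨g, hg⟩ := exists_eq_succ_of_mk_eq_zero hf hf0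
    refine ⟨fun i => c i + (p : ℤ) ^ m * d i, g, ?_⟩
    have hprod : (∏ i, u i ^ (c i + (p : ℤ) ^ m * d i)) =
        (∏ i, u i ^ c i) * ∏ i, (u i ^ p ^ m) ^ d i := by
      rw [← Finset.prod_mul_distrib]
      refine Finset.prod_congr rfl fun i _ => ?_
      rw [zpow_add, zpow_mul, ← Nat.cast_pow, zpow_natCast]
    rw [hprod, mul_inv, ← mul_assoc]
    exact hg

/-- **Divisibility of exponents (injectivity induction).**  Let `uᵢ = 1 + p² aᵢ` where the
`aᵢ mod p` are linearly independent over `𝔽_p` in `A/p`, and let `p` be a non-zero-divisor of `A`.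
If a monomial `∏ uᵢ^{cᵢ}` has level `2 + m` then `p^m ∣ cᵢ` for all `i`: by induction, writing
`cᵢ = p^m dᵢ`, the digit of `∏ uᵢ^{p^m dᵢ}` at level `2 + m` is `∑ dᵢ aᵢ`, which vanishes only
if `p ∣ dᵢ`.  Ref: Serre, *Local Fields*, Ch. IV §2, Prop. 6 and §3 Prop. 9; Neukirch,
*Algebraic Number Theory*, Ch. II (5.7). [folklore] -/
theorem dvd_of_prod_zpow (hreg : ∀ x : A, (p : A) * x = 0 → x = 0)
    (hind : ∀ d : Fin n → ℤ, ∑ i, d i • Ideal.Quotient.mk (Ideal.span {(p : A)}) (a i) = 0 →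
      ∀ i, (p : ℤ) ∣ d i)
    (hu : ∀ i, (u i : A) = 1 + (p : A) ^ 2 * a i) (m : ℕ) (c : Fin n → ℤ)
    (hc : ∃ b, ((∏ i, u i ^ c i : Aˣ) : A) = 1 + (p : A) ^ (2 + m) * b) :
    ∀ i, (p : ℤ) ^ m ∣ c i := by
  induction m generalizing c with
  | zero => intro i; rw [pow_zero]; exact one_dvd _
  | succ m ih =>
    obtain ⟨b, hb⟩ := hc
    have hc' : ∃ b', ((∏ i, u i ^ c i : Aˣ) : A) = 1 + (p : A) ^ (2 + m) * b' :=
      exists_eq_of_add (k := 2 + m) 1 hb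
    have hdvd := ih c hc'
    choose d hd using hdvd
    -- `cᵢ = p^m dᵢ`; the digit of `∏ uᵢ^{p^m dᵢ}` at level `2+m` is `∑ dᵢ aᵢ`
    have hum : ∀ i ∈ (Finset.univ : Finset (Fin n)), ((u i ^ p ^ m : Aˣ) : A) =
        1 + (p : A) ^ (2 + m) * (exists_pow_prime_pow_eq p le_rfl (hu i) m).choose :=
      fun i _ => (exists_pow_prime_pow_eq p le_rfl (hu i) m).choose_spec.1
    obtain ⟨e, he, heq⟩ := exists_prod_zpow_eq (P := (p : A)) (by omega) Finset.univ hum d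
    have hprod : (∏ i, u i ^ c i : Aˣ) = ∏ i, (u i ^ p ^ m) ^ d i := by
      refine Finset.prod_congr rfl fun i _ => ?_
      rw [hd i, zpow_mul, ← Nat.cast_pow, zpow_natCast]
    rw [hprod, show 2 + (m + 1) = 2 + m + 1 by ring] at hb
    have he0 : Ideal.Quotient.mk (Ideal.span {(p : A)}) e = 0 := mk_eq_zero_of_eq_succ hreg he hb
    rw [heq] at he0
    have he0' : ∑ i, d i • Ideal.Quotient.mk (Ideal.span {(p : A)}) (a i) = 0 := by
      rw [← he0]
      refine Finset.sum_congr rfl fun i _ => ?_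
      rw [(exists_pow_prime_pow_eq p le_rfl (hu i) m).choose_spec.2]
    intro i
    obtain ⟨d', hd'⟩ := hind d he0' i
    rw [hd i, hd', pow_succ]
    exact ⟨d', by ring⟩

end Basis

/-! ### `p`-adic utilities -/

section Padic

variable (p : ℕ) [Fact p.Prime]

/-- The level sets of `ℤ_p → ℤ/p^m` are open (`z ≡ z₀ (mod p^m)` on the ball of radius `p^{-m}`).
[folklore] -/
theorem isOpen_setOf_toZModPow_eq (m : ℕ) (t : ZMod (p ^ m)) :
    IsOpen {z : ℤ_[p] | PadicInt.toZModPow m z = t} := by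
  rw [Metric.isOpen_iff]
  intro z₀ hz₀
  refine ⟨(p : ℝ) ^ (-(m : ℤ)), zpow_pos (by exact_mod_cast (Fact.out : p.Prime).pos) _,
    fun z hz => ?_⟩
  have hle : ‖z - z₀‖ ≤ (p : ℝ) ^ (-(m : ℤ)) := by
    rw [← dist_eq_norm]; exact (Metric.mem_ball.1 hz).le
  rw [PadicInt.norm_le_pow_iff_mem_span_pow, ← PadicInt.ker_toZModPow, RingHom.mem_ker, map_sub,
    sub_eq_zero] at hle
  rw [Set.mem_setOf_eq] at hz₀ ⊢
  rw [hle, hz₀]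

/-- `ℤ_p → ℤ/p^m` is continuous for the discrete topology on `ℤ/p^m`. [folklore] -/
theorem continuous_toZModPow (m : ℕ) :
    Continuous (PadicInt.toZModPow m : ℤ_[p] → ZMod (p ^ m)) :=
  continuous_discrete_rng.2 fun t => isOpen_setOf_toZModPow_eq p m t

/-- **Continuity criterion for `ℤ_p`-valued maps**: `f` is continuous as soon as each reduction
`f mod p^m` is locally constant.  [folklore] -/
theorem continuous_of_toZModPow_eventually_eq {X : Type*} [TopologicalSpace X] {f : X → ℤ_[p]}
    (h : ∀ (m : ℕ) (x₀ : X), ∀ᶠ x in 𝓝 x₀,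
      PadicInt.toZModPow m (f x) = PadicInt.toZModPow m (f x₀)) :
    Continuous f := by
  refine continuous_iff_continuousAt.2 fun x₀ => ?_
  rw [ContinuousAt, Metric.tendsto_nhds]
  intro ε hε
  obtain ⟨m, hm⟩ := PadicInt.exists_pow_neg_lt p hε
  filter_upwards [h m x₀] with x hx
  rw [dist_eq_norm]
  refine lt_of_le_of_lt ?_ hm
  rw [PadicInt.norm_le_pow_iff_mem_span_pow, ← PadicInt.ker_toZModPow, RingHom.mem_ker, map_sub, hx,
    sub_self]

omit [Fact p.Prime] in
/-- Two `p`-adic integers with the same reductions modulo every `p^m` are equal, phrased for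
integers: if `p^m ∣ a - b` in `ℤ` then `a ≡ b` in `ℤ/p^m`. [folklore] -/
theorem intCast_eq_intCast_of_dvd {m : ℕ} {a b : ℤ} (h : (p : ℤ) ^ m ∣ a - b) :
    (a : ZMod (p ^ m)) = (b : ZMod (p ^ m)) := by
  rw [ZMod.intCast_eq_intCast_iff_dvd_sub, ← neg_sub, dvd_neg]
  exact_mod_cast h

end Padic

/-! ### Bases of finite `𝔽_p`-vector spaces, with integer coefficients -/

section BasisInt

variable (p : ℕ) [Fact p.Prime]

/-- A finite `𝔽_p`-vector space `Q` has `p^n` elements, `n = dim Q`, and a basis `b₁, …, b_n`;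
phrased with integer coefficients: every `q` is `∑ dᵢ bᵢ` with `dᵢ ∈ ℤ`, and `∑ dᵢ bᵢ = 0` forces
`p ∣ dᵢ`. [folklore] -/
theorem exists_basis_int {Q : Type*} [AddCommGroup Q] [Module (ZMod p) Q] [Module.Finite (ZMod p) Q] :
    ∃ (n : ℕ) (b : Fin n → Q), Nat.card Q = p ^ n ∧
      (∀ q : Q, ∃ d : Fin n → ℤ, q = ∑ i, d i • b i) ∧
      (∀ d : Fin n → ℤ, ∑ i, d i • b i = 0 → ∀ i, (p : ℤ) ∣ d i) := by
  let bQ := Module.finBasis (ZMod p) Q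
  have hsmul : ∀ (d : ℤ) (q : Q), d • q = (d : ZMod p) • q := fun d q =>
    (Int.cast_smul_eq_zsmul (ZMod p) d q).symm
  refine ⟨Module.finrank (ZMod p) Q, bQ, ?_, fun q => ?_, fun d hd i => ?_⟩
  · rw [Module.natCard_eq_pow_finrank (K := ZMod p) (V := Q), Nat.card_zmod]
  · refine ⟨fun i => ((bQ.repr q i).val : ℤ), ?_⟩
    conv_lhs => rw [← bQ.sum_repr q]
    refine Finset.sum_congr rfl fun i _ => ?_
    rw [hsmul, Int.cast_natCast, ZMod.natCast_zmod_val]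
  · have hli := Fintype.linearIndependent_iff.1 bQ.linearIndependent (fun i => (d i : ZMod p))
    rw [← ZMod.intCast_zmod_eq_zero_iff_dvd]
    refine hli ?_ i
    rw [← hd]
    exact Finset.sum_congr rfl fun i _ => by rw [hsmul]

end BasisInt

/-! ### The main theorem -/

section Main

variable {A : Type*} [CommRing A] [TopologicalSpace A] [IsTopologicalRing A] [CompactSpace A]
  [T2Space A] (p : ℕ) [Fact p.Prime]

omit [CompactSpace A] [T2Space A] [Fact p.Prime] in
/-- The level-`k` one-units `{x | x = 1 + p^k b}` form an open set of `Aˣ` when `p^k A` is open.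
[folklore] -/
theorem isOpen_setOf_exists_eq_one_add (k : ℕ)
    (hopen : IsOpen ((Ideal.span {(p : A) ^ k} : Ideal A) : Set A)) :
    IsOpen {x : Aˣ | ∃ b, (x : A) = 1 + (p : A) ^ k * b} := by
  have h1 : {x : Aˣ | ∃ b, (x : A) = 1 + (p : A) ^ k * b} =
      Units.val ⁻¹' ((fun y : A => y - 1) ⁻¹' ((Ideal.span {(p : A) ^ k} : Ideal A) : Set A)) := by
    ext x
    simp only [Set.mem_setOf_eq, Set.mem_preimage, SetLike.mem_coe, Ideal.mem_span_singleton']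
    constructor
    · rintro ⟨b, hb⟩; exact ⟨b, by rw [hb]; ring⟩
    · rintro ⟨b, hb⟩; exact ⟨b, by rw [mul_comm, hb]; ring⟩
  rw [h1]
  exact (hopen.preimage (continuous_id.sub continuous_const)).preimage Units.continuous_val

/-- **The one-units of a compact `p`-adic ring have `ℤ_p`-rank `dim_{𝔽_p} A/p`.**  Let `A` be a
compact Hausdorff topological commutative ring and `p` a prime which is a non-zero-divisor of `A`,
lies in the Jacobson radical (`1 + pa` is a unit for all `a`), and generates open ideals `p^m A`
(e.g. `A = 𝒪_v` the valuation ring of a finite place `v ∣ p` of a number field).  Put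
`p^n = #(A/pA)`.  Then there are `n` continuous characters `φ₁, …, φ_n : Aˣ → ℤ_p` whose joint
image contains `p^N ℤ_pⁿ` for some `N` — i.e. `Hom_cont(Aˣ, ℤ_p)` has `ℤ_p`-rank (at least) `n`;
for `A = 𝒪_v`, `n = [K_v : ℚ_p]` and this is the statement `U_v^{(1)} ≃ (finite) × ℤ_p^{[K_v:ℚ_p]}`.
Proof: with `uᵢ = 1 + p² aᵢ`, `(aᵢ mod p)` an `𝔽_p`-basis of `A/p`, every `w ∈ U₂ = 1 + p²A` is
`≡ ∏ uᵢ^{cᵢ} (mod U_{2+m})` with `cᵢ ∈ ℤ` unique modulo `p^m` (`exists_zpow_approx`,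
`dvd_of_prod_zpow`); the resulting compatible coordinates `U₂ → (ℤ/p^m)ⁿ` glue (`PadicInt.lift`)
to continuous `φᵢ : U₂ → ℤ_p`, jointly onto `ℤ_pⁿ` by compactness, and are extended to `Aˣ`
through `x ↦ x^h`, `h = [Aˣ : U₂]`.
Ref: Serre, *Local Fields*, Ch. IV §2 Prop. 6, §3 Prop. 9, Ch. XIV §4 (structure of `U^1`);
Neukirch, *Algebraic Number Theory*, Ch. II (5.7) (i): "`U^{(n)} ≅ ℤ_p^d`, `d = [K:ℚ_p]`, for `n`
large"; Washington, *Introduction to Cyclotomic Fields*, §13.1, proof of Thm. 13.4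
(`rank_{ℤ_p} U_{1,𝔭} = [K_𝔭 : ℚ_p]`).
This version also records the kernel: there is `h ≠ 0` (the index `[Aˣ : U₂]`) such that every
`x` with all `φᵢ x = 0` satisfies `x^h ≡ 1 (mod p^m)` for every `m` (so `x^h = 1` when
`⋂ p^m A = 0`): the joint character is injective modulo torsion. [folklore] -/
theorem exists_continuousMonoidHom_forall_exists_ker
    (hreg : ∀ a : A, (p : A) * a = 0 → a = 0) (hunit : ∀ a : A, IsUnit (1 + (p : A) * a))
    (hopen : ∀ m : ℕ, IsOpen ((Ideal.span {(p : A) ^ m} : Ideal A) : Set A)) :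
    ∃ (n N : ℕ) (φ : Fin n → (Aˣ →ₜ* Multiplicative ℤ_[p])),
      Nat.card (A ⧸ Ideal.span {(p : A)}) = p ^ n ∧
      (∀ x : Fin n → ℤ_[p], ∃ u : Aˣ, ∀ i, (φ i u).toAdd = (p : ℤ_[p]) ^ N * x i) ∧
      ∃ h : ℕ, h ≠ 0 ∧ ∀ x : Aˣ, (∀ i, φ i x = 1) →
        ∀ m : ℕ, ((x ^ h : Aˣ) : A) - 1 ∈ Ideal.span {(p : A) ^ m} := by
  classical
  have hp : p.Prime := Fact.out
  /- Step 0: `A/p` is a finite `𝔽_p`-vector space; pick a basis and lift it. -/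
  have hopen1 : IsOpen (((Ideal.span {(p : A)}).toAddSubgroup : AddSubgroup A) : Set A) := by
    rw [Submodule.coe_toAddSubgroup]
    simpa only [pow_one] using hopen 1
  haveI hfin : Finite (A ⧸ Ideal.span {(p : A)}) :=
    AddSubgroup.quotient_finite_of_isOpen (Ideal.span {(p : A)}).toAddSubgroup hopen1
  letI inst : Module (ZMod p) (A ⧸ Ideal.span {(p : A)}) :=
    AddCommGroup.zmodModule (by
      intro x
      obtain ⟨y, rfl⟩ := Ideal.Quotient.mk_surjective x
      rw [← map_nsmul, nsmul_eq_mul, Ideal.Quotient.eq_zero_iff_mem]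
      exact Ideal.mem_span_singleton'.2 ⟨y, mul_comm _ _⟩)
  haveI instf : Module.Finite (ZMod p) (A ⧸ Ideal.span {(p : A)}) := Module.Finite.of_finite
  obtain ⟨n, bQ, hcard, hspanQ, hindQ⟩ :=
    @exists_basis_int p _ (A ⧸ Ideal.span {(p : A)}) _ inst instf
  have hbsurj : ∀ i : Fin n, ∃ x : A, Ideal.Quotient.mk (Ideal.span {(p : A)}) x = bQ i :=
    fun i => Ideal.Quotient.mk_surjective (bQ i)
  choose a ha using hbsurj
  let u : Fin n → Aˣ := fun i => (hunit ((p : A) * a i)).unit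
  have hu : ∀ i, (u i : A) = 1 + (p : A) ^ 2 * a i := fun i => by
    rw [IsUnit.unit_spec]; ring
  have hspan : ∀ q : A ⧸ Ideal.span {(p : A)}, ∃ d : Fin n → ℤ,
      q = ∑ i, d i • Ideal.Quotient.mk (Ideal.span {(p : A)}) (a i) := fun q => by
    simp only [ha]; exact hspanQ q
  have hind : ∀ d : Fin n → ℤ, ∑ i, d i • Ideal.Quotient.mk (Ideal.span {(p : A)}) (a i) = 0 →
      ∀ i, (p : ℤ) ∣ d i := fun d hd => by
    simp only [ha] at hd; exact hindQ d hd
  /- Step 1: the subgroups `U_k = 1 + p^k A` (as membership predicates) and `U₂`. -/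
  have hmul : ∀ {k : ℕ}, 1 ≤ k → ∀ {x y : Aˣ}, (∃ b, (x : A) = 1 + (p : A) ^ k * b) →
      (∃ b, (y : A) = 1 + (p : A) ^ k * b) → ∃ b, ((x * y : Aˣ) : A) = 1 + (p : A) ^ k * b :=
    fun hk x y ⟨b, hb⟩ ⟨b', hb'⟩ => let ⟨d, hd, _⟩ := exists_mul_eq hk hb hb'; ⟨d, hd⟩
  have hinv : ∀ {k : ℕ}, 1 ≤ k → ∀ {x : Aˣ}, (∃ b, (x : A) = 1 + (p : A) ^ k * b) →
      ∃ b, ((x⁻¹ : Aˣ) : A) = 1 + (p : A) ^ k * b :=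
    fun hk x ⟨b, hb⟩ => let ⟨d, hd, _⟩ := exists_inv_eq hk hb; ⟨d, hd⟩
  have hpow : ∀ {k : ℕ}, 1 ≤ k → ∀ {x : Aˣ}, (∃ b, (x : A) = 1 + (p : A) ^ k * b) →
      ∀ j : ℕ, ∃ b, ((x ^ j : Aˣ) : A) = 1 + (p : A) ^ k * b :=
    fun hk x ⟨b, hb⟩ j => let ⟨d, hd, _⟩ := exists_zpow_eq hk hb j; ⟨d, by rw [← hd, zpow_natCast]⟩
  let U2 : Subgroup Aˣ :=
    { carrier := {x | ∃ b, (x : A) = 1 + (p : A) ^ 2 * b}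
      one_mem' := ⟨0, by rw [Units.val_one, mul_zero, add_zero]⟩
      mul_mem' := fun hx hy => hmul (by norm_num) hx hy
      inv_mem' := fun hx => hinv (by norm_num) hx }
  have hU2open : IsOpen (U2 : Set Aˣ) := isOpen_setOf_exists_eq_one_add p 2 (hopen 2)
  haveI : Finite (Aˣ ⧸ U2) := Subgroup.quotient_finite_of_isOpen U2 hU2open
  haveI : U2.FiniteIndex := Subgroup.finiteIndex_of_finite_quotient
  set h : ℕ := U2.index with hh_def
  have hh0 : h ≠ 0 := Subgroup.FiniteIndex.index_ne_zero
  have hxh : ∀ x : Aˣ, ∃ b, ((x ^ h : Aˣ) : A) = 1 + (p : A) ^ 2 * b := fun x =>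
    Subgroup.pow_index_mem U2 x
  -- monomials
  have hM_add : ∀ c c' : Fin n → ℤ,
      (∏ i, u i ^ (c i + c' i)) = (∏ i, u i ^ c i) * ∏ i, u i ^ c' i := fun c c' => by
    rw [← Finset.prod_mul_distrib]
    exact Finset.prod_congr rfl fun i _ => zpow_add _ _ _
  have hM_sub : ∀ c c' : Fin n → ℤ,
      (∏ i, u i ^ (c i - c' i)) = (∏ i, u i ^ c i) * (∏ i, u i ^ c' i)⁻¹ := fun c c' => by
    rw [← div_eq_mul_inv, ← Finset.prod_div_distrib]
    exact Finset.prod_congr rfl fun i _ => zpow_sub _ _ _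
  have hM_nsmul : ∀ (j : ℕ) (c : Fin n → ℤ),
      (∏ i, u i ^ ((j : ℤ) * c i)) = (∏ i, u i ^ c i) ^ j := fun j c => by
    rw [← Finset.prod_pow]
    exact Finset.prod_congr rfl fun i _ => by rw [mul_comm, zpow_mul, zpow_natCast]
  /- Step 2: level-`m` coordinates of `x^h`, unique modulo `p^m`. -/
  have key : ∀ (m : ℕ) (x : Aˣ), ∃ (c : Fin n → ℤ) (b : A),
      ((x ^ h * (∏ i, u i ^ c i)⁻¹ : Aˣ) : A) = 1 + (p : A) ^ (2 + m) * b := fun m x =>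
    exists_zpow_approx p hspan hu m (x ^ h) (hxh x)
  choose C hC using key
  have huniq : ∀ (m : ℕ) (x : Aˣ) (c : Fin n → ℤ),
      (∃ b, ((x ^ h * (∏ i, u i ^ c i)⁻¹ : Aˣ) : A) = 1 + (p : A) ^ (2 + m) * b) →
        ∀ i, (p : ℤ) ^ m ∣ c i - C m x i := by
    intro m x c hc i
    have h1 : ∃ b, (((x ^ h * (∏ i, u i ^ C m x i)⁻¹)⁻¹ * (x ^ h * (∏ i, u i ^ c i)⁻¹) : Aˣ) : A) =
        1 + (p : A) ^ (2 + m) * b := hmul (by omega) (hinv (by omega) (hC m x)) hc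
    have h2 : (x ^ h * (∏ i, u i ^ C m x i)⁻¹)⁻¹ * (x ^ h * (∏ i, u i ^ c i)⁻¹) =
        ∏ i, u i ^ (C m x i - c i) := by
      rw [hM_sub, mul_inv, inv_inv, mul_comm (x ^ h)⁻¹, mul_assoc, ← mul_assoc (x ^ h)⁻¹,
        inv_mul_cancel, one_mul]
    rw [h2] at h1
    have h3 := dvd_of_prod_zpow p hreg hind hu m _ h1 i
    rw [← dvd_neg, neg_sub]
    exact h3
  -- the coordinate maps are additive and compatible
  have hC_mul : ∀ (m : ℕ) (x y : Aˣ) (i : Fin n),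
      (p : ℤ) ^ m ∣ (C m x i + C m y i) - C m (x * y) i := fun m x y i => by
    refine huniq m (x * y) (fun i => C m x i + C m y i) ?_ i
    have h1 := hmul (by omega : 1 ≤ 2 + m) (hC m x) (hC m y)
    refine h1.imp fun b hb => ?_
    rw [← hb, hM_add, mul_pow, mul_inv, mul_mul_mul_comm]
  have hC_mono : ∀ {m m' : ℕ}, m ≤ m' → ∀ (x : Aˣ) (i : Fin n),
      (p : ℤ) ^ m ∣ C m' x i - C m x i := fun {m m'} hmm' x i => by
    refine huniq m x (C m' x) ?_ i
    obtain ⟨j, rfl⟩ := Nat.exists_eq_add_of_le hmm'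
    obtain ⟨b, hb⟩ := hC (m + j) x
    refine exists_eq_of_add (k := 2 + m) (e := b) j ?_
    rw [hb, add_assoc]
  /- Step 3: glue the coordinates into `ℤ_p`-valued characters via `PadicInt.lift`. -/
  let g : Fin n → ∀ m : ℕ, Aˣ → ZMod (p ^ m) := fun i m x => (C m x i : ZMod (p ^ m))
  have hg_mul : ∀ i m x y, g i m (x * y) = g i m x + g i m y := fun i m x y => by
    change (C m (x * y) i : ZMod (p ^ m)) = (C m x i : ZMod (p ^ m)) + (C m y i : ZMod (p ^ m))
    rw [← Int.cast_add]
    exact (intCast_eq_intCast_of_dvd p (hC_mul m x y i)).symm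
  have hg_cast : ∀ i {m m' : ℕ} (hmm' : m ≤ m') (x : Aˣ),
      ZMod.castHom (pow_dvd_pow p hmm') (ZMod (p ^ m)) (g i m' x) = g i m x := fun i m m' hmm' x => by
    change ZMod.castHom _ (ZMod (p ^ m)) (C m' x i : ZMod (p ^ m')) = (C m x i : ZMod (p ^ m))
    rw [map_intCast]
    exact intCast_eq_intCast_of_dvd p (hC_mono hmm' x i)
  let f : Fin n → ∀ m : ℕ, MvPolynomial Aˣ ℤ →+* ZMod (p ^ m) := fun i m =>
    MvPolynomial.eval₂Hom (Int.castRingHom _) (g i m)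
  have hf_compat : ∀ i (m1 m2 : ℕ) (hk : m1 ≤ m2),
      (ZMod.castHom (pow_dvd_pow p hk) (ZMod (p ^ m1))).comp (f i m2) = f i m1 := fun i m1 m2 hk => by
    refine MvPolynomial.ringHom_ext (fun r => ?_) (fun x => ?_)
    · simp only [f, map_intCast, eq_intCast]
    · simp only [f, RingHom.coe_comp, Function.comp_apply, MvPolynomial.eval₂Hom_X']
      exact hg_cast i hk x
  let φf : Fin n → Aˣ → ℤ_[p] := fun i x => PadicInt.lift (hf_compat i) (MvPolynomial.X x)
  have hφf_spec : ∀ i m x, PadicInt.toZModPow m (φf i x) = g i m x := fun i m x => by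
    change ((PadicInt.toZModPow m).comp (PadicInt.lift (hf_compat i))) (MvPolynomial.X x) = g i m x
    rw [PadicInt.lift_spec]
    exact MvPolynomial.eval₂Hom_X' _ _ x
  have hφf_mul : ∀ i x y, φf i (x * y) = φf i x * 1 + φf i y := fun i x y => by
    rw [mul_one, ← PadicInt.ext_of_toZModPow]
    intro m
    rw [map_add, hφf_spec, hφf_spec, hφf_spec, hg_mul]
  have hφf_one : ∀ i, φf i 1 = 0 := fun i => by
    have h1 := hφf_mul i 1 1
    rw [mul_one, mul_one, left_eq_add] at h1
    exact h1
  -- continuity: `g i m` is constant on `x₀ · U_{2+m}`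
  have hφf_cont : ∀ i, Continuous (φf i) := fun i => by
    refine continuous_of_toZModPow_eventually_eq p fun m x₀ => ?_
    have hVopen : IsOpen {v : Aˣ | ∃ b, (v : A) = 1 + (p : A) ^ (2 + m) * b} :=
      isOpen_setOf_exists_eq_one_add p (2 + m) (hopen (2 + m))
    have hmem : x₀ ∈ (fun v => x₀ * v) '' {v : Aˣ | ∃ b, (v : A) = 1 + (p : A) ^ (2 + m) * b} :=
      ⟨1, ⟨0, by rw [Units.val_one, mul_zero, add_zero]⟩, mul_one x₀⟩
    filter_upwards [((isOpenMap_mul_left x₀) _ hVopen).mem_nhds hmem] with x hx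
    obtain ⟨v, hv, rfl⟩ := hx
    rw [hφf_spec, hφf_spec]
    change (C m (x₀ * v) i : ZMod (p ^ m)) = (C m x₀ i : ZMod (p ^ m))
    refine (intCast_eq_intCast_of_dvd p (huniq m (x₀ * v) (C m x₀) ?_ i)).symm
    obtain ⟨b, hb⟩ := hmul (by omega : 1 ≤ 2 + m) (hC m x₀) (hpow (by omega) hv h)
    refine ⟨b, ?_⟩
    rw [← hb, mul_pow, mul_assoc, mul_assoc, mul_comm ((∏ i, u i ^ C m x₀ i)⁻¹)]
  let φ : Fin n → (Aˣ →ₜ* Multiplicative ℤ_[p]) := fun i =>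
    { toFun := fun x => Multiplicative.ofAdd (φf i x)
      map_one' := by rw [hφf_one]; rfl
      map_mul' := fun x y => by rw [hφf_mul, mul_one, ofAdd_add]
      continuous_toFun := continuous_ofAdd.comp (hφf_cont i) }
  have hφ : ∀ i x, (φ i x).toAdd = φf i x := fun i x => rfl
  /- Step 4: joint surjectivity onto `h · ℤ_pⁿ` by compactness. -/
  have hsurj : ∀ y : Fin n → ℤ_[p], ∃ x : Aˣ, ∀ i, φf i x = (h : ℤ_[p]) * y i := by
    intro y
    let S : ℕ → Set Aˣ := fun m =>
      {x | ∀ i, PadicInt.toZModPow m (φf i x) = PadicInt.toZModPow m ((h : ℤ_[p]) * y i)}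
    have hS_closed : ∀ m, IsClosed (S m) := fun m => by
      have : S m = ⋂ i, (fun x => PadicInt.toZModPow m (φf i x)) ⁻¹'
          {PadicInt.toZModPow m ((h : ℤ_[p]) * y i)} := by
        ext x; simp only [S, Set.mem_setOf_eq, Set.mem_iInter, Set.mem_preimage, Set.mem_singleton_iff]
      rw [this]
      exact isClosed_iInter fun i =>
        (isClosed_singleton.preimage ((continuous_toZModPow p m).comp (hφf_cont i)))
    have hS_anti : ∀ {m m' : ℕ}, m ≤ m' → S m' ⊆ S m := fun {m m'} hmm' x hx i => by
      have := congrArg (ZMod.cast : ZMod (p ^ m') → ZMod (p ^ m)) (hx i)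
      rwa [PadicInt.cast_toZModPow m m' hmm', PadicInt.cast_toZModPow m m' hmm'] at this
    have hS_ne : ∀ m, (S m).Nonempty := fun m => by
      let t : Fin n → ℤ := fun i => ((PadicInt.toZModPow m (y i)).val : ℤ)
      refine ⟨∏ i, u i ^ t i, fun i => ?_⟩
      rw [hφf_spec, map_mul, map_natCast]
      change (C m (∏ i, u i ^ t i) i : ZMod (p ^ m)) = (h : ZMod (p ^ m)) * PadicInt.toZModPow m (y i)
      have ht : ((t i : ℤ) : ZMod (p ^ m)) = PadicInt.toZModPow m (y i) := by
        simp only [t, Int.cast_natCast, ZMod.natCast_zmod_val]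
      rw [← ht, ← Int.cast_natCast, ← Int.cast_mul]
      refine (intCast_eq_intCast_of_dvd p (huniq m _ (fun i => (h : ℤ) * t i) ⟨0, ?_⟩ i)).symm
      rw [hM_nsmul, mul_inv_cancel, Units.val_one, mul_zero, add_zero]
    obtain ⟨x, hx⟩ := IsCompact.nonempty_iInter_of_directed_nonempty_isCompact_isClosed S
      (fun m m' => ⟨max m m', hS_anti (le_max_left _ _), hS_anti (le_max_right _ _)⟩)
      hS_ne (fun m => (hS_closed m).isCompact) hS_closed
    refine ⟨x, fun i => PadicInt.ext_of_toZModPow.1 fun m => ?_⟩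
    exact (Set.mem_iInter.1 hx m) i
  /- Step 5: `h = p^N · unit`. -/
  have hhp : (h : ℤ_[p]) ≠ 0 := by exact_mod_cast hh0
  refine ⟨n, (h : ℤ_[p]).valuation, φ, hcard, fun x => ?_, h, hh0, fun x hx m => ?_⟩
  · obtain ⟨w, hw⟩ := hsurj fun i => ((PadicInt.unitCoeff hhp)⁻¹ : ℤ_[p]ˣ) * x i
    refine ⟨w, fun i => ?_⟩
    rw [hφ, hw, ← mul_assoc]
    congr 1
    have hspec := PadicInt.unitCoeff_spec hhp
    nth_rewrite 1 [hspec]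
    rw [mul_comm, ← mul_assoc, Units.inv_mul, one_mul]
  /- Step 6: the kernel. If all `φᵢ x = 0` then all level-`m` coordinates of `x^h` vanish, so
    `x^h ∈ U_{2+m}` for every `m`. -/
  · have hC0 : ∀ i, (p : ℤ) ^ m ∣ C m x i := fun i => by
      have h1 : PadicInt.toZModPow m (φf i x) = 0 := by
        have := hx i
        rw [← hφ i x, this, toAdd_one, map_zero]
      rw [hφf_spec] at h1
      change (C m x i : ZMod (p ^ m)) = 0 at h1
      have h2 := (ZMod.intCast_zmod_eq_zero_iff_dvd (C m x i) (p ^ m)).1 h1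
      exact_mod_cast h2
    choose d hd using hC0
    -- the monomial `∏ uᵢ^{C m x i} = (∏ uᵢ^{dᵢ})^{p^m}` lies in `U_{2+m}`
    have hMd : ∃ b, ((∏ i, u i ^ d i : Aˣ) : A) = 1 + (p : A) ^ 2 * b :=
      U2.prod_mem fun i _ => U2.zpow_mem ⟨a i, hu i⟩ (d i)
    obtain ⟨b, hb⟩ := hMd
    obtain ⟨b', hb', -⟩ := exists_pow_prime_pow_eq p le_rfl hb m
    have hMC : (∏ i, u i ^ C m x i) = (∏ i, u i ^ d i) ^ p ^ m := by
      rw [← hM_nsmul]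
      refine Finset.prod_congr rfl fun i _ => ?_
      rw [hd i, Nat.cast_pow]
    have hxh : ∃ b, ((x ^ h : Aˣ) : A) = 1 + (p : A) ^ (2 + m) * b := by
      have h1 := hmul (by omega : 1 ≤ 2 + m) (hC m x) ⟨b', by rw [← hMC] at hb'; exact hb'⟩
      rwa [inv_mul_cancel_right] at h1
    obtain ⟨b'', hb''⟩ := hxh
    rw [hb'', add_sub_cancel_left, pow_add]
    exact Ideal.mem_span_singleton'.2 ⟨(p : A) ^ 2 * b'', by ring⟩

/-- **The one-units of a compact `p`-adic ring have `ℤ_p`-rank `dim_{𝔽_p} A/p`** (existence of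
`n` characters with open joint image; see `exists_continuousMonoidHom_forall_exists_ker` for the
version recording the kernel).  Let `A` be a compact Hausdorff topological commutative ring and
`p` a prime which is a non-zero-divisor of `A`, lies in the Jacobson radical, and generates open
ideals `p^m A`; put `p^n = #(A/pA)`.  Then there are `n` continuous characters
`φ₁, …, φ_n : Aˣ → ℤ_p` whose joint image contains `p^N ℤ_pⁿ` for some `N`.
Ref: Serre, *Local Fields*, Ch. IV §2 Prop. 6, §3 Prop. 9; Neukirch, *Algebraic Number Theory*,
Ch. II (5.7) (i); Washington, *Introduction to Cyclotomic Fields*, §13.1, proof of Thm. 13.4.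
[folklore] -/
theorem exists_continuousMonoidHom_forall_exists
    (hreg : ∀ a : A, (p : A) * a = 0 → a = 0) (hunit : ∀ a : A, IsUnit (1 + (p : A) * a))
    (hopen : ∀ m : ℕ, IsOpen ((Ideal.span {(p : A) ^ m} : Ideal A) : Set A)) :
    ∃ (n N : ℕ) (φ : Fin n → (Aˣ →ₜ* Multiplicative ℤ_[p])),
      Nat.card (A ⧸ Ideal.span {(p : A)}) = p ^ n ∧
      ∀ x : Fin n → ℤ_[p], ∃ u : Aˣ, ∀ i, (φ i u).toAdd = (p : ℤ_[p]) ^ N * x i := by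
  obtain ⟨n, N, φ, hcard, hsurj, -⟩ := exists_continuousMonoidHom_forall_exists_ker p hreg hunit hopen
  exact ⟨n, N, φ, hcard, hsurj⟩

/-- **Injectivity modulo torsion.**  If moreover `⋂_m p^m A = 0` (e.g. `A` a valuation ring,
`p ≠ 0`), the characters `φᵢ` of `exists_continuousMonoidHom_forall_exists_ker` detect elements
of infinite order: `φᵢ x = 0` for all `i` forces `x` to have finite order (`x^h = 1`).  With the
open joint image this says `Aˣ / torsion ≃ ℤ_pⁿ`-lattice, i.e. `rank_{ℤ_p} Hom_cont(Aˣ, ℤ_p) = n`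
exactly.  Ref: Neukirch, *Algebraic Number Theory*, Ch. II (5.7) (i) (`U^{(1)} ≅ ℤ/p^a ⊕ ℤ_p^d`);
Washington, §13.1. [folklore] -/
theorem exists_continuousMonoidHom_forall_exists_isOfFinOrder
    (hreg : ∀ a : A, (p : A) * a = 0 → a = 0) (hunit : ∀ a : A, IsUnit (1 + (p : A) * a))
    (hopen : ∀ m : ℕ, IsOpen ((Ideal.span {(p : A) ^ m} : Ideal A) : Set A))
    (hsep : ∀ a : A, (∀ m : ℕ, a ∈ Ideal.span {(p : A) ^ m}) → a = 0) :
    ∃ (n N : ℕ) (φ : Fin n → (Aˣ →ₜ* Multiplicative ℤ_[p])),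
      Nat.card (A ⧸ Ideal.span {(p : A)}) = p ^ n ∧
      (∀ x : Fin n → ℤ_[p], ∃ u : Aˣ, ∀ i, (φ i u).toAdd = (p : ℤ_[p]) ^ N * x i) ∧
      ∀ x : Aˣ, (∀ i, φ i x = 1) → IsOfFinOrder x := by
  obtain ⟨n, N, φ, hcard, hsurj, h, hh0, hker⟩ :=
    exists_continuousMonoidHom_forall_exists_ker p hreg hunit hopen
  refine ⟨n, N, φ, hcard, hsurj, fun x hx => ?_⟩
  have h1 : ((x ^ h : Aˣ) : A) - 1 = 0 := hsep _ (hker x hx)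
  rw [sub_eq_zero, ← Units.val_one] at h1
  exact isOfFinOrder_iff_pow_eq_one.2 ⟨h, Nat.pos_of_ne_zero hh0, Units.ext h1⟩


/-- **Rank at most `n`.**  Under the hypotheses of
`exists_continuousMonoidHom_forall_exists_isOfFinOrder` (`⋂ p^m A = 0`), every continuous
character `ψ : Aˣ → ℤ_p` is a `ℤ_p`-linear combination of the `φᵢ` after multiplication by
`p^N`: `p^N ψ = ∑ cᵢ φᵢ`.  Indeed `ψ` kills the (torsion) kernel of `Φ = (φᵢ) : Aˣ → Λ ⊆ ℤ_pⁿ`,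
so `ψ = ψ̃ ∘ Φ` with `ψ̃ : Λ → ℤ_p` additive and continuous (`Φ` is a quotient map, `Aˣ` being
compact), hence `ℤ_p`-linear on `p^N ℤ_pⁿ ⊆ Λ` (density of `ℕ` in `ℤ_p`).  Together with the open
joint image: `Hom_cont(Aˣ, ℤ_p) ⊗ ℚ_p` has dimension exactly `n` (`= [K_v : ℚ_p]` for `A = 𝒪_v`).
Ref: Neukirch, *Algebraic Number Theory*, Ch. II (5.7) (i); Washington, *Introduction to
Cyclotomic Fields*, §13.1, proof of Thm. 13.4 (`rank_{ℤ_p} U_1 = [K:ℚ_p]`). [folklore] -/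
theorem exists_forall_pow_mul_eq_sum
    (hreg : ∀ a : A, (p : A) * a = 0 → a = 0) (hunit : ∀ a : A, IsUnit (1 + (p : A) * a))
    (hopen : ∀ m : ℕ, IsOpen ((Ideal.span {(p : A) ^ m} : Ideal A) : Set A))
    (hsep : ∀ a : A, (∀ m : ℕ, a ∈ Ideal.span {(p : A) ^ m}) → a = 0) :
    ∃ (n N : ℕ) (φ : Fin n → (Aˣ →ₜ* Multiplicative ℤ_[p])),
      Nat.card (A ⧸ Ideal.span {(p : A)}) = p ^ n ∧
      (∀ x : Fin n → ℤ_[p], ∃ u : Aˣ, ∀ i, (φ i u).toAdd = (p : ℤ_[p]) ^ N * x i) ∧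
      ∀ ψ : Aˣ →ₜ* Multiplicative ℤ_[p], ∃ c : Fin n → ℤ_[p], ∀ x : Aˣ,
        (p : ℤ_[p]) ^ N * (ψ x).toAdd = ∑ i, c i * (φ i x).toAdd := by
  classical
  obtain ⟨n, N, φ, hcard, hsurj, hker⟩ :=
    exists_continuousMonoidHom_forall_exists_isOfFinOrder p hreg hunit hopen hsep
  refine ⟨n, N, φ, hcard, hsurj, fun ψ => ?_⟩
  -- the joint character `Φ : Aˣ → ℤ_pⁿ` and its image `Λ`
  let Φ : Aˣ → (Fin n → ℤ_[p]) := fun x i => (φ i x).toAdd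
  have hΦ_mul : ∀ x y, Φ (x * y) = Φ x + Φ y := fun x y => by
    funext i; simp only [Φ, map_mul, toAdd_mul, Pi.add_apply]
  have hΦ_one : Φ 1 = 0 := by funext i; simp only [Φ, map_one, toAdd_one, Pi.zero_apply]
  have hΦ_inv : ∀ x, Φ x⁻¹ = -Φ x := fun x => by
    have h1 := hΦ_mul x⁻¹ x
    rw [inv_mul_cancel, hΦ_one] at h1
    exact eq_neg_of_add_eq_zero_left h1.symm
  have hΦ_cont : Continuous Φ := continuous_pi fun i => continuous_toAdd.comp (φ i).continuous
  let Λ : AddSubgroup (Fin n → ℤ_[p]) :=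
    { carrier := Set.range Φ
      zero_mem' := ⟨1, hΦ_one⟩
      add_mem' := by rintro _ _ ⟨x, rfl⟩ ⟨y, rfl⟩; exact ⟨x * y, hΦ_mul x y⟩
      neg_mem' := by rintro _ ⟨x, rfl⟩; exact ⟨x⁻¹, hΦ_inv x⟩ }
  let ΦΛ : Aˣ → Λ := fun x => ⟨Φ x, x, rfl⟩
  have hΦΛ_cont : Continuous ΦΛ := continuous_induced_rng.2 hΦ_cont
  have hΦΛ_surj : Function.Surjective ΦΛ := by
    rintro ⟨_, x, rfl⟩; exact ⟨x, rfl⟩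
  have hquot : Topology.IsQuotientMap ΦΛ :=
    (hΦΛ_cont.isClosedMap).isQuotientMap hΦΛ_cont hΦΛ_surj
  -- `ψ` is constant on the fibres of `Φ` (the kernel is torsion, `ℤ_p` is torsion-free)
  let ψa : Aˣ → ℤ_[p] := fun x => (ψ x).toAdd
  have hψa_mul : ∀ x y, ψa (x * y) = ψa x + ψa y := fun x y => by
    simp only [ψa, map_mul, toAdd_mul]
  have hψa_one : ψa 1 = 0 := by simp only [ψa, map_one, toAdd_one]
  have hψa_inv : ∀ x, ψa x⁻¹ = -ψa x := fun x => by
    have h1 := hψa_mul x⁻¹ x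
    rw [inv_mul_cancel, hψa_one] at h1
    exact eq_neg_of_add_eq_zero_left h1.symm
  have hψa_cont : Continuous ψa := continuous_toAdd.comp ψ.continuous
  have hψa_tors : ∀ x : Aˣ, IsOfFinOrder x → ψa x = 0 := fun x hx => by
    obtain ⟨k, hk, hxk⟩ := hx.exists_pow_eq_one
    have h1 : ∀ j : ℕ, ψa (x ^ j) = j • ψa x := fun j => by
      induction j with
      | zero => rw [pow_zero, hψa_one, zero_smul]
      | succ j ih => rw [pow_succ, hψa_mul, ih, succ_nsmul]
    have h2 : k • ψa x = 0 := by rw [← h1, hxk, hψa_one]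
    rw [nsmul_eq_mul, mul_eq_zero] at h2
    exact h2.resolve_left (by exact_mod_cast hk.ne')
  have hfib : ∀ x y : Aˣ, Φ x = Φ y → ψa x = ψa y := fun x y hxy => by
    have h1 : ∀ i, φ i (x * y⁻¹) = 1 := fun i => by
      apply Multiplicative.toAdd.injective
      have := congrFun (hΦ_mul x y⁻¹) i
      rw [hΦ_inv, hxy, add_neg_cancel] at this
      rw [toAdd_one]; exact this
    have h2 := hψa_tors _ (hker _ h1)
    rw [hψa_mul, hψa_inv] at h2
    linear_combination h2
  -- descend `ψ` to an additive continuous `ψt : Λ → ℤ_p`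
  have hdesc : ∀ l : Λ, ∃ z : ℤ_[p], ∀ x, Φ x = l.1 → ψa x = z := fun l => by
    obtain ⟨x₀, hx₀⟩ := l.2
    exact ⟨ψa x₀, fun x hx => hfib x x₀ (hx.trans hx₀.symm)⟩
  choose ψt hψt using hdesc
  have hψt_Φ : ∀ x, ψt (ΦΛ x) = ψa x := fun x => (hψt (ΦΛ x) x rfl).symm
  have hψt_cont : Continuous ψt := by
    rw [hquot.continuous_iff]
    have : ψt ∘ ΦΛ = ψa := funext hψt_Φ
    rw [this]; exact hψa_cont
  have hψt_add : ∀ l l' : Λ, ψt (l + l') = ψt l + ψt l' := by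
    intro l l'
    obtain ⟨x, rfl⟩ := hΦΛ_surj l
    obtain ⟨y, rfl⟩ := hΦΛ_surj l'
    have h1 : ΦΛ x + ΦΛ y = ΦΛ (x * y) := Subtype.ext (hΦ_mul x y).symm
    rw [h1, hψt_Φ, hψt_Φ, hψt_Φ, hψa_mul]
  let ψh : Λ →+ ℤ_[p] :=
    { toFun := ψt
      map_zero' := by
        have h1 := hψt_add 0 0
        rw [add_zero, left_eq_add] at h1
        exact h1
      map_add' := hψt_add }
  -- `p^N ℤ_pⁿ ⊆ Λ`
  have hpN : ∀ z : Fin n → ℤ_[p], (fun i => (p : ℤ_[p]) ^ N * z i) ∈ Λ := fun z => by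
    obtain ⟨u, hu⟩ := hsurj z
    exact ⟨u, funext hu⟩
  -- the embedding `ℤ_pⁿ → Λ`, `z ↦ p^N z`, as an additive continuous map
  let ι : (Fin n → ℤ_[p]) →+ Λ :=
    { toFun := fun z => ⟨fun i => (p : ℤ_[p]) ^ N * z i, hpN z⟩
      map_zero' := Subtype.ext (funext fun i => by simp)
      map_add' := fun z z' => Subtype.ext (funext fun i => by
        simp only [Pi.add_apply, AddSubgroup.coe_add, mul_add]) }
  have hι_cont : Continuous ι :=
    continuous_induced_rng.2 (continuous_pi fun i => continuous_const.mul (continuous_apply i))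
  -- `F = ψh ∘ ι : ℤ_pⁿ →+ ℤ_p` is continuous, hence `ℤ_p`-linear: `F z = ∑ zᵢ F(eᵢ)`
  let F : (Fin n → ℤ_[p]) →+ ℤ_[p] := ψh.comp ι
  have hF_cont : Continuous F := hψt_cont.comp hι_cont
  have hF_smul : ∀ (c : ℤ_[p]) (z : Fin n → ℤ_[p]), F (c • z) = c * F z := by
    intro c z
    have hc1 : Continuous fun c : ℤ_[p] => F (c • z) := hF_cont.comp (continuous_id.smul continuous_const)
    have hc2 : Continuous fun c : ℤ_[p] => c * F z := continuous_id.mul continuous_const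
    have hnat : ∀ k : ℕ, F ((k : ℤ_[p]) • z) = (k : ℤ_[p]) * F z := fun k => by
      rw [Nat.cast_smul_eq_nsmul, map_nsmul, nsmul_eq_mul]
    have heq := hc1.ext_on (PadicInt.denseRange_natCast (p := p)) hc2 (fun x hx => by
      obtain ⟨k, rfl⟩ := hx; exact hnat k)
    exact congrFun heq c
  have hF_lin : ∀ z : Fin n → ℤ_[p], F z = ∑ j, z j * F (Pi.single j 1) := fun z => by
    conv_lhs => rw [show z = ∑ j, z j • (Pi.single j (1 : ℤ_[p]) : Fin n → ℤ_[p]) from by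
      ext i; simp [Finset.sum_apply, Pi.single_apply]]
    rw [map_sum]
    exact Finset.sum_congr rfl fun j _ => hF_smul _ _
  refine ⟨fun j => F (Pi.single j 1), fun x => ?_⟩
  -- `p^N ψ x = ψt (p^N Φ x) = F (Φ x)`
  have h1 : ι (Φ x) = (p ^ N) • ΦΛ x := by
    apply Subtype.ext
    funext i
    change (p : ℤ_[p]) ^ N * Φ x i = ((p ^ N) • ΦΛ x : Λ).1 i
    rw [AddSubgroup.coe_nsmul, Pi.smul_apply, nsmul_eq_mul, Nat.cast_pow]
  have h2 : F (Φ x) = (p : ℤ_[p]) ^ N * ψa x := by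
    change ψt (ι (Φ x)) = _
    rw [h1, ← hψt_Φ x]
    change ψh ((p ^ N) • ΦΛ x) = _
    rw [map_nsmul, nsmul_eq_mul, Nat.cast_pow]; rfl
  rw [← h2, hF_lin]
  exact Finset.sum_congr rfl fun j _ => mul_comm _ _

end Main

end OneUnits

end Literature.NumberTheory.GaloisRepresentations
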